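import Literature.Topology.FourManifolds.LinkLeeStates
import Literature.Topology.FourManifolds.KhResolutionsDichotomyProofs
import HarnessLib

/-!
# Merge or split: the dichotomy for checkerboard-coloured link Gauss diagrams (link tower, T1b)

Layer T1b of the link tower `LinkGaussDiagrams` (D1: `LinkGaussDiagram`, `next`, `Arc`,
`arcOut`, `arcIn`, `unknots`, `birth`, `death`, `saddle`) → `LinkKhResolutions` (D2a: `State`,
`isSeifert`, `stateGraph`, `circleOf`, `IsMergeAt`, `IsSplitAt`, `endArc`, `endFlip`, `endGlue`,
`IsMergeAt.not_isSplitAt`, `hopfLink`) → `LinkKhComplex` (D2b) → `LinkLeeStates` (D2c: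
`IsCheckerboard`, `isCheckerboard_ofGaussDiagram`, `isCheckerboard_unknots`,
`isCheckerboard_hopfLink`) → **this file**, the port to `LinkGaussDiagram` of the knot tower's
`GaussDiagram.isMergeAt_or_isSplitAt_of_overPos_mod_two_ne` (`KhResolutionsDichotomyProofs`,
on top of the `farEnd` machinery of `KhResolutionsProofs`):

* `isMergeAt_or_isSplitAt_of_isCheckerboard` — **if a link Gauss diagram `L` admits a
  checkerboard colouring `c` (`c (next p) = !c p` along every component,
  `c (underPos i) = !c (overPos i)` at every chord), then at every `0`-smoothed chord `i` of
  every state `σ` the edge `σ → σ[i ↦ 1]` of the cube of resolutions is a merge or a split**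
  (never the one-to-one, single-circle bifurcation of virtual diagrams). For knot diagrams a
  checkerboard colouring is Gauss parity (`isCheckerboard_ofGaussDiagram`) and the knot
  statement is recovered (`GaussDiagram.isMergeAt_or_isSplitAt_of_overPos_mod_two_ne'`); for
  diagrams of links in `ℝ³` it is Rasmussen's "Seifert circles sharing a crossing carry
  different labels" (Rasmussen (2010), Lemma 2.4), i.e. orientability of the state surfaces.
* `dichotomy_of_isCheckerboard`, `dichotomy_of_exists_isCheckerboard`: the same in the shape
  `∀ σ i, σ i = false → L.IsMergeAt σ i ∨ L.IsSplitAt σ i` consumed by the `d² = 0` face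
  analysis of the link Khovanov complex; `isMergeAt_iff_not_isSplitAt_of_isCheckerboard`.

## Proof: the walk along the erased resolution, tracking the colour

Fix a state `σ` and a chord `i` with over-passage `o` and under-passage `u`. Starting from the
arc-end `e₀ = (o, out)` we walk along the resolution of `σ` with the crossing `i` erased: one
step (`strandStep σ i = restGlue σ i ∘ endFlip`) crosses the current arc to its other end
(`endFlip`, built from `next` / `next⁻¹` in D2a) and then follows the gluing of `σ` (`endGlue`)
unless that other end already lies at chord `i`, where the walk stalls (`restGlue`). The walk
`strandWalk σ i k = (strandStep σ i)^[k] e₀` comes back to chord `i`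
(`exists_isEndAt_endFlip_strandWalk`: `strandStep` is injective on the finite set of arc-ends,
so the walk is periodic, and the glued step entering `e₀` can only start from an end at chord
`i`); the **far end** `farEnd σ i` is the end at chord `i` reached first (after
`returnTime σ i` glued steps, a `Nat.find`). Along the walk the colour of the current marked
point is constant (`IsCheckerboard.apply_strandWalk`): crossing an arc changes it
(`c (next p) = !c p`) and so does every gluing (`c (partner p) = !c p`); the last, stalling,
step only crosses an arc, so the far end has the colour opposite to that of `o`, which is the
colour of `u`: **the far end lies at the under-passage** (`IsCheckerboard.farEnd_fst`), never
at `(o, in)`. Finally (`circleOf_ne_of_endGlue_eq_farEnd`, no colouring needed): if a state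
`τ ∈ {σ, σ[i ↦ 1]}` glues `e₀` to the far end, the arcs traversed by the walk form a union of
circles of `τ` through `arcOut o` avoiding `arcIn o`, so the two local strands at `i` lie on
different circles of `τ`; and exactly one of `σ`, `σ[i ↦ 1]` does so, according as the far end
is `(u, in)` or `(u, out)` and as the smoothing of `σ` at `i` is Seifert's or not
(`endGlue_overPos_true`, `isSeifert_update_true`) — a merge if it is `σ`, a split if it is
`σ[i ↦ 1]`.

Free circles (`inr` arcs) carry no arc-end and are never touched by the walk
(`endArc_ne_inr`, `inr_not_mem_strandArcs`); they are state circles on their own in every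
state (`circleOf_inr_eq_iff` of D2a), so they do not interfere.

## Ported versus reused

Ported from `KhResolutionsProofs` by the rule `p ± 1 ↦ next p / next⁻¹ p`: `IsEndAt`,
`restGlue`, `endArc_eq_endArc_iff` (an arc has exactly its two ends),
`exists_end_of_stateGraph_adj`, `circleOf_ne_of_endGlue_eq_farEnd`, `endGlue_overPos_true`,
`isSeifert_update_true`, and, from `KhResolutionsDichotomyProofs`, the colour bookkeeping
(`IsCheckerboard.apply_endFlip/apply_endGlue/apply_strandStep_of_(not_)isEndAt/
apply_strandWalk/apply_farEnd/farEnd_fst` replace the `… _val_mod_two` lemmas, Gauss parity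
being replaced by the colour `c`) and the final four-case analysis of
`isMergeAt_or_isSplitAt_of_overPos_mod_two_ne`, verbatim. SIMPLIFIED rather than ported: the
knot tower handles the walk algebraically (strand permutation `ρ`, `ℤ`-powers, the dihedral
relation `F ρᵏ F = ρ⁻ᵏ`, evenness of the period, `farEnd = ρ^(m/2) e₀`, `eq_self_or_eq_farEnd`,
`not_isEndAt_pow_apply`); here the far end is the FIRST return of the forward walk to chord `i`,
which makes "no end at chord `i` strictly inside the walk" hold by definition
(`not_isEndAt_strandWalk_succ`) and removes the period bookkeeping (both define the same end:
the first return happens at step `m/2`). Reused as they stand: `GaussDiagram.mem_of_reachable`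
(a vertex set closed under adjacency absorbs reachability), D2a's `endArc`, `endFlip`, `endGlue`,
`endGlue_update_of_ne`, `IsMergeAt.not_isSplitAt`, D2c's `IsCheckerboard.apply_symm`,
`IsCheckerboard.apply_partner`, and, for the sanity checks only, the knot tower's
`GaussDiagram.dichotomy_iff_overPos_mod_two_ne`.

## Also here

* sanity: the knot statement on `ofGaussDiagram G` under Gauss parity, re-derived through
  `isCheckerboard_ofGaussDiagram` and transported back by D2a's `isMergeAt_ofGaussDiagram_iff` /
  `isSplitAt_ofGaussDiagram_iff` (`GaussDiagram.isMergeAt_or_isSplitAt_of_overPos_mod_two_ne'`,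
  the statement of the unprimed knot theorem), and `dichotomy_ofGaussDiagram_iff` (for knot
  diagrams the link-side dichotomy is equivalent to Gauss parity); `unknots k` (vacuous); the
  Hopf link (every edge of its cube is a merge or a split; by `decide`: merges out of `00`,
  splits out of `10` and `01`);
* checkerboard colourings under the Morse moves of D1: unchanged by `birth` / `death`
  (`isCheckerboard_birth_iff`, `isCheckerboard_death_iff`), and preserved by the saddle
  `saddle p q` (`next ↦ next * swap p q`) exactly when `c p = c q` — the band joins two arcs of
  the same colour, the combinatorial form of "an oriented saddle is a band between coherently
  oriented arcs" (`IsCheckerboard.saddle`, `IsCheckerboard.apply_eq_of_saddle`,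
  `isCheckerboard_saddle_iff`); hence the dichotomy persists along a movie of births, deaths
  and oriented saddles (`dichotomy_birth`, `dichotomy_death`, `dichotomy_saddle`).

Not here: the converse "dichotomy ⇒ checkerboard-colourable" is false for links (a virtual
two-component diagram may satisfy the dichotomy without admitting a checkerboard colouring), so
no `iff` is stated beyond knot diagrams; realisability of link diagrams by links in `ℝ³`.

## References

* O. Viro, *Khovanov homology, its definitions and ramifications*, Fund. Math. 184 (2004)
  317–342, §5.2 (adjacent states differ by a Morse modification joining two circles or
  splitting one; the one-to-one bifurcation of virtual diagrams). [cite: Viro2004, §5.2]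
* J. Rasmussen, *Khovanov homology and the slice genus*, Invent. Math. 182 (2010) 419–447,
  Lemma 2.4, Cor. 2.5 (adjacent Seifert circles carry different labels), §4.1 (Morse moves).
  [cite: Rasmussen2010, §2.3]
* D. Bar-Natan, *On Khovanov's categorification of the Jones polynomial*, Algebr. Geom.
  Topol. 2 (2002) 337–370, §3.1 (every edge of the cube of a planar diagram is a merge or a
  split). [cite: BarNatan2002, §3.1]
* L. H. Kauffman, *Virtual knot theory*, European J. Combin. 20 (1999) 663–690, §2 (Gauss's
  parity condition). [cite: Kauffman1999, §2]
-/

open Function Set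

noncomputable section

namespace Literature.Topology.FourManifolds

namespace LinkGaussDiagram

variable (L : LinkGaussDiagram)

/-! ## Ends at a chord and the rest gluing (port of `KhResolutionsProofs`) -/

/-- The arc-end `e = (p, b)` **lies at chord `i`**: its marked point `p` is one of the two
passages `overPos i`, `underPos i` of chord `i` (verbatim `GaussDiagram.IsEndAt`). [folklore] -/
def IsEndAt (i : Fin L.n) (e : Fin (2 * L.n) × Bool) : Prop :=
  e.1 = L.overPos i ∨ e.1 = L.underPos i

/-- Lying at chord `i` is decidable. [folklore] -/
instance (i : Fin L.n) : DecidablePred (L.IsEndAt i) := fun e ↦ by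
  unfold IsEndAt; infer_instance

/-- The end `(overPos i, out)`, the start of the walk, lies at chord `i`. [folklore] -/
theorem isEndAt_overPos_true (i : Fin L.n) : L.IsEndAt i (L.overPos i, true) := Or.inl rfl

/-- The gluing `endGlue` (which moves an end to the partner point) preserves lying at chord `i`.
[folklore] -/
theorem isEndAt_endGlue_iff (σ : L.State) (i : Fin L.n) (e : Fin (2 * L.n) × Bool) :
    L.IsEndAt i (L.endGlue σ e) ↔ L.IsEndAt i e := by
  obtain ⟨p, b⟩ := e
  simp only [IsEndAt, endGlue]
  constructor
  · rintro (h | h)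
    · right; simpa using congrArg L.partner h
    · left; simpa using congrArg L.partner h
  · rintro (h | h)
    · right; simp [h]
    · left; simp [h]

/-- The **rest gluing** at chord `i` in the state `σ`: ends away from chord `i` are glued by the
smoothings of `σ` (`endGlue`), the four ends at chord `i` are left unglued (verbatim
`GaussDiagram.restGlue`). [folklore] -/
def restGlue (σ : L.State) (i : Fin L.n) (e : Fin (2 * L.n) × Bool) : Fin (2 * L.n) × Bool :=
  if L.IsEndAt i e then e else L.endGlue σ e

variable {L} in
/-- `restGlue` fixes the ends at chord `i`. [folklore] -/
theorem restGlue_of_isEndAt {σ : L.State} {i : Fin L.n} {e : Fin (2 * L.n) × Bool}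
    (h : L.IsEndAt i e) : L.restGlue σ i e = e := if_pos h

variable {L} in
/-- `restGlue` away from chord `i` is the gluing of `σ`. [folklore] -/
theorem restGlue_of_not_isEndAt {σ : L.State} {i : Fin L.n} {e : Fin (2 * L.n) × Bool}
    (h : ¬ L.IsEndAt i e) : L.restGlue σ i e = L.endGlue σ e := if_neg h

/-- `restGlue σ i` is an involution. [folklore] -/
@[simp]
theorem restGlue_restGlue (σ : L.State) (i : Fin L.n) (e : Fin (2 * L.n) × Bool) :
    L.restGlue σ i (L.restGlue σ i e) = e := by
  by_cases h : L.IsEndAt i e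
  · rw [restGlue_of_isEndAt h, restGlue_of_isEndAt h]
  · have h' : ¬ L.IsEndAt i (L.endGlue σ e) := by rwa [isEndAt_endGlue_iff]
    rw [restGlue_of_not_isEndAt h, restGlue_of_not_isEndAt h', endGlue_endGlue]

/-! ## The walk along the erased resolution from `(overPos i, out)` -/

/-- One **step of the walk** along the resolution of `σ` with the crossing `i` erased: cross the
current arc to its other end (`endFlip`), then follow the gluing of `σ`, stalling at the ends of
chord `i` (`restGlue`). This is the strand permutation `ρ` of `KhResolutionsProofs` as a function.
[folklore] -/
def strandStep (σ : L.State) (i : Fin L.n) (e : Fin (2 * L.n) × Bool) : Fin (2 * L.n) × Bool :=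
  L.restGlue σ i (L.endFlip e)

/-- A step of the walk is injective (a composite of two involutions). [folklore] -/
theorem strandStep_injective (σ : L.State) (i : Fin L.n) : Injective (L.strandStep σ i) := by
  intro e e' h
  have h' := congrArg (fun x ↦ L.endFlip (L.restGlue σ i x)) h
  simpa only [strandStep, restGlue_restGlue, endFlip_endFlip] using h'

/-- **The walk** along the erased resolution of `σ` at chord `i`, started at the end
`(overPos i, out)`: `k` steps of `strandStep σ i`. [folklore] -/
def strandWalk (σ : L.State) (i : Fin L.n) (k : ℕ) : Fin (2 * L.n) × Bool :=
  (L.strandStep σ i)^[k] (L.overPos i, true)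

/-- The walk starts at `(overPos i, out)`. [folklore] -/
@[simp]
theorem strandWalk_zero (σ : L.State) (i : Fin L.n) : L.strandWalk σ i 0 = (L.overPos i, true) :=
  rfl

/-- One more step of the walk. [folklore] -/
theorem strandWalk_succ (σ : L.State) (i : Fin L.n) (k : ℕ) :
    L.strandWalk σ i (k + 1) = L.restGlue σ i (L.endFlip (L.strandWalk σ i k)) :=
  Function.iterate_succ_apply' _ _ _

/-- **The walk returns to chord `i`**: for some `k` the other end of the arc of
`strandWalk σ i k` lies at chord `i`. Otherwise every step is glued, the walk is an orbit of the
injective map `strandStep σ i` on the finite set of arc-ends and hence comes back to its start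
`e₀ = (overPos i, out)`; but the end glued to `e₀` is an end at chord `i`. [folklore] -/
theorem exists_isEndAt_endFlip_strandWalk (σ : L.State) (i : Fin L.n) :
    ∃ k, L.IsEndAt i (L.endFlip (L.strandWalk σ i k)) := by
  by_contra h
  push Not at h
  obtain ⟨a, b, hab, heq⟩ := Finite.exists_ne_map_eq_of_infinite (L.strandWalk σ i)
  wlog hlt : a < b generalizing a b
  · exact this b a hab.symm heq.symm (lt_of_le_of_ne (not_lt.mp hlt) hab.symm)
  obtain ⟨d, rfl⟩ : ∃ d, b = a + (d + 1) := ⟨b - a - 1, by omega⟩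
  -- cancelling `a` steps: the walk is back at `e₀` after `d + 1` steps
  have h1 : L.strandWalk σ i (d + 1) = (L.overPos i, true) := by
    apply (L.strandStep_injective σ i).iterate a
    show (L.strandStep σ i)^[a] ((L.strandStep σ i)^[d + 1] (L.overPos i, true)) =
      (L.strandStep σ i)^[a] (L.overPos i, true)
    rw [← Function.iterate_add_apply]
    exact heq.symm
  -- the last of these steps is glued, so it starts from the end glued to `e₀`, at chord `i`
  rw [strandWalk_succ, restGlue_of_not_isEndAt (h d)] at h1
  refine h d ?_
  rw [← L.endGlue_endGlue σ (L.endFlip (L.strandWalk σ i d)), h1, isEndAt_endGlue_iff]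
  exact L.isEndAt_overPos_true i

/-- The **return time**: the least `k` such that the other end of the arc of `strandWalk σ i k`
lies at chord `i` (the number of glued steps before the walk first comes back to chord `i`).
[folklore] -/
def returnTime (σ : L.State) (i : Fin L.n) : ℕ :=
  Nat.find (L.exists_isEndAt_endFlip_strandWalk σ i)

/-- The **far end**: the arc-end at chord `i` at which the walk along the erased resolution from
`(overPos i, out)` first comes back to chord `i` (the knot tower's `farEnd σ i (overPos i, out)`,
there defined as `ρ^(m/2) e₀` through the period `m` of the strand permutation). [folklore] -/
def farEnd (σ : L.State) (i : Fin L.n) : Fin (2 * L.n) × Bool :=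
  L.endFlip (L.strandWalk σ i (L.returnTime σ i))

/-- The far end lies at chord `i`. [folklore] -/
theorem isEndAt_farEnd (σ : L.State) (i : Fin L.n) : L.IsEndAt i (L.farEnd σ i) :=
  Nat.find_spec (L.exists_isEndAt_endFlip_strandWalk σ i)

variable {L}

section Walk

variable {σ : L.State} {i : Fin L.n} {k : ℕ}

/-- Before the return time the other end of the current arc is not at chord `i`. [folklore] -/
theorem not_isEndAt_endFlip_strandWalk (hk : k < L.returnTime σ i) :
    ¬ L.IsEndAt i (L.endFlip (L.strandWalk σ i k)) :=
  Nat.find_min (L.exists_isEndAt_endFlip_strandWalk σ i) hk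

/-- Before the return time every step of the walk is glued by `σ`. [folklore] -/
theorem strandWalk_succ_of_lt (hk : k < L.returnTime σ i) :
    L.strandWalk σ i (k + 1) = L.endGlue σ (L.endFlip (L.strandWalk σ i k)) := by
  rw [strandWalk_succ, restGlue_of_not_isEndAt (not_isEndAt_endFlip_strandWalk hk)]

/-- **Strictly between the start and the far end the walk does not visit chord `i`** (here by
the very definition of the far end as the first return; in the knot tower this is
`not_isEndAt_pow_apply`, from `eq_self_or_eq_farEnd`). [folklore] -/
theorem not_isEndAt_strandWalk_succ (hk : k < L.returnTime σ i) :
    ¬ L.IsEndAt i (L.strandWalk σ i (k + 1)) := by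
  rw [strandWalk_succ_of_lt hk, isEndAt_endGlue_iff]
  exact not_isEndAt_endFlip_strandWalk hk

end Walk

/-! ## Colours along the walk -/

section Colour

variable {c : Fin (2 * L.n) → Bool}

/-- Crossing an arc changes the colour of the marked point (`c (next p) = !c p`, read in both
directions). This replaces `GaussDiagram.endFlip_fst_val_mod_two` (parity of `p ± 1`).
[folklore] -/
theorem IsCheckerboard.apply_endFlip (hc : L.IsCheckerboard c) (e : Fin (2 * L.n) × Bool) :
    c (L.endFlip e).1 = !c e.1 := by
  obtain ⟨p, _ | _⟩ := e
  · exact hc.apply_symm p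
  · exact hc.apply_next p

/-- Every gluing changes the colour of the marked point (`c (partner p) = !c p`). This replaces
`GaussDiagram.endGlue_fst_val_mod_two` (Gauss parity of the chords). [folklore] -/
theorem IsCheckerboard.apply_endGlue (hc : L.IsCheckerboard c) (σ : L.State)
    (e : Fin (2 * L.n) × Bool) : c (L.endGlue σ e).1 = !c e.1 := by
  obtain ⟨p, b⟩ := e
  exact hc.apply_partner p

/-- **Invariance.** A glued step of the walk (the other end of the arc is not at chord `i`)
preserves the colour of the marked point. [folklore] -/
theorem IsCheckerboard.apply_strandStep_of_not_isEndAt (hc : L.IsCheckerboard c) {σ : L.State}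
    {i : Fin L.n} {e : Fin (2 * L.n) × Bool} (h : ¬ L.IsEndAt i (L.endFlip e)) :
    c (L.strandStep σ i e).1 = c e.1 := by
  rw [strandStep, restGlue_of_not_isEndAt h, hc.apply_endGlue, hc.apply_endFlip, Bool.not_not]

/-- A stalling step of the walk (the other end of the arc lies at chord `i`) changes the colour
of the marked point. [folklore] -/
theorem IsCheckerboard.apply_strandStep_of_isEndAt (hc : L.IsCheckerboard c) {σ : L.State}
    {i : Fin L.n} {e : Fin (2 * L.n) × Bool} (h : L.IsEndAt i (L.endFlip e)) :
    c (L.strandStep σ i e).1 = !c e.1 := by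
  rw [strandStep, restGlue_of_isEndAt h, hc.apply_endFlip]

/-- **The colour of the marked point is constant along the walk up to the return time** (every
step before the far end is glued). [folklore] -/
theorem IsCheckerboard.apply_strandWalk (hc : L.IsCheckerboard c) (σ : L.State) (i : Fin L.n)
    {k : ℕ} (hk : k ≤ L.returnTime σ i) : c (L.strandWalk σ i k).1 = c (L.overPos i) := by
  induction k with
  | zero => rfl
  | succ k ih =>
    rw [strandWalk_succ]
    exact (hc.apply_strandStep_of_not_isEndAt (not_isEndAt_endFlip_strandWalk hk)).trans
      (ih (Nat.le_of_succ_le hk))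

/-- **The far end has the colour opposite to that of the over-passage**: the last step only
crosses an arc. [folklore] -/
theorem IsCheckerboard.apply_farEnd (hc : L.IsCheckerboard c) (σ : L.State) (i : Fin L.n) :
    c (L.farEnd σ i).1 = !c (L.overPos i) := by
  rw [farEnd, hc.apply_endFlip, hc.apply_strandWalk σ i le_rfl]

/-- **Under a checkerboard colouring the walk from the over-passage of chord `i` first returns
to chord `i` at the under-passage** (the two passages have opposite colours; port of
`GaussDiagram.farEnd_overPos_fst_eq_underPos`). [folklore] -/
theorem IsCheckerboard.farEnd_fst (hc : L.IsCheckerboard c) (σ : L.State) (i : Fin L.n) :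
    (L.farEnd σ i).1 = L.underPos i := by
  have h1 := hc.apply_farEnd σ i
  rcases L.isEndAt_farEnd σ i with h | h
  · rw [h] at h1
    exact absurd h1.symm (Bool.not_ne_self _)
  · exact h

/-- In particular the far end is never `(overPos i, in)`: **the single-circle bifurcation of
virtual diagrams is excluded** by a checkerboard colouring (in the knot tower,
`farEnd = (overPos i, in)` is the case `not_reachable_eraseGraph_of_farEnd_eq` of the
trichotomy). Viro (2004), §5.2. [cite: Viro2004, §5.2] -/
theorem IsCheckerboard.farEnd_ne_overPos (hc : L.IsCheckerboard c) (σ : L.State) (i : Fin L.n)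
    (b : Bool) : L.farEnd σ i ≠ (L.overPos i, b) := fun h ↦
  L.overPos_ne_underPos i i ((congrArg Prod.fst h).symm.trans (hc.farEnd_fst σ i))

end Colour

/-! ## The arcs of the walk separate the two local strands -/

variable (L)

/-- **An arc has exactly its two ends**: `endArc e = endArc e'` iff `e'` is `e` or the other end
`endFlip e` of the same arc (port of `GaussDiagram.endArc_eq_endArc_iff`, with `next`).
[folklore] -/
theorem endArc_eq_endArc_iff {e e' : Fin (2 * L.n) × Bool} :
    L.endArc e = L.endArc e' ↔ e' = e ∨ e' = L.endFlip e := by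
  constructor
  · intro h
    obtain ⟨p, _ | _⟩ := e <;> obtain ⟨q, _ | _⟩ := e'
    · obtain rfl : p = q := L.arcIn_injective h
      exact Or.inl rfl
    · have h' : L.arcOut (L.next.symm p) = L.arcOut q := h
      obtain rfl : L.next.symm p = q := L.arcOut_injective h'
      exact Or.inr rfl
    · have h' : L.arcOut p = L.arcOut (L.next.symm q) := h
      have hq : q = L.next p := by
        rw [L.arcOut_injective h', Equiv.apply_symm_apply]
      subst hq
      exact Or.inr rfl
    · obtain rfl : p = q := L.arcOut_injective h
      exact Or.inl rfl
  · rintro (rfl | rfl)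
    · rfl
    · exact (L.endArc_endFlip e).symm

/-- An arc-end lies on an arc leaving a marked point, never on a free circle. [folklore] -/
theorem endArc_ne_inr (e : Fin (2 * L.n) × Bool) (j : Fin L.free) : L.endArc e ≠ .inr j := by
  obtain ⟨p, _ | _⟩ := e <;> exact Sum.inl_ne_inr

/-- Adjacency in the state graph of `τ` comes from a glued pair of ends (port of
`GaussDiagram.exists_end_of_stateAdj`). [folklore] -/
theorem exists_end_of_stateAdj (τ : L.State) {a b : L.Arc} (h : L.stateAdj τ a b) :
    ∃ e, L.endArc e = a ∧ L.endArc (L.endGlue τ e) = b := by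
  obtain ⟨-, p, ⟨hs, h⟩ | ⟨hs, h⟩⟩ := h
  · rcases h with ⟨rfl, rfl⟩ | ⟨rfl, rfl⟩
    · exact ⟨(p, false), rfl, by simp [endArc, endGlue, hs]⟩
    · exact ⟨(L.partner p, true), rfl, by simp [endArc, endGlue, hs]⟩
  · rcases h with ⟨rfl, rfl⟩ | ⟨rfl, rfl⟩
    · exact ⟨(p, false), rfl, by simp [endArc, endGlue, hs]⟩
    · exact ⟨(p, true), rfl, by simp [endArc, endGlue, hs]⟩

/-- Adjacency in the state graph of `τ` comes from a glued pair of ends (symmetrised form).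
[folklore] -/
theorem exists_end_of_stateGraph_adj (τ : L.State) {a b : L.Arc}
    (h : (L.stateGraph τ).Adj a b) : ∃ e, L.endArc e = a ∧ L.endArc (L.endGlue τ e) = b := by
  rw [stateGraph, SimpleGraph.fromRel_adj] at h
  obtain ⟨-, h | h⟩ := h
  · exact L.exists_end_of_stateAdj τ h
  · obtain ⟨e, hb, ha⟩ := L.exists_end_of_stateAdj τ h
    exact ⟨L.endGlue τ e, ha, by simpa using hb⟩

/-- The **arcs of the walk**: the arcs carrying the ends `strandWalk σ i k` for
`k ≤ returnTime σ i` (the arcs traversed from `(overPos i, out)` up to the far end; the knot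
tower's `strandArcs`). [folklore] -/
def strandArcs (σ : L.State) (i : Fin L.n) : Set L.Arc :=
  {a | ∃ k ≤ L.returnTime σ i, L.endArc (L.strandWalk σ i k) = a}

/-- **Free circles do not interfere**: no free circle is an arc of the walk. [folklore] -/
theorem inr_not_mem_strandArcs (σ : L.State) (i : Fin L.n) (j : Fin L.free) :
    (.inr j : L.Arc) ∉ L.strandArcs σ i := by
  rintro ⟨k, -, h⟩
  exact L.endArc_ne_inr _ j h

/-- The arc leaving the over-passage is an arc of the walk (its first arc). [folklore] -/
theorem arcOut_mem_strandArcs (σ : L.State) (i : Fin L.n) :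
    L.arcOut (L.overPos i) ∈ L.strandArcs σ i :=
  ⟨0, Nat.zero_le _, rfl⟩

variable {L}

/-- An arc is an arc of the walk iff one of its two ends is a point of the walk or the other end
of one. [folklore] -/
theorem endArc_mem_strandArcs_iff {σ : L.State} {i : Fin L.n} (e : Fin (2 * L.n) × Bool) :
    L.endArc e ∈ L.strandArcs σ i ↔ ∃ k ≤ L.returnTime σ i,
      e = L.strandWalk σ i k ∨ e = L.endFlip (L.strandWalk σ i k) := by
  constructor
  · rintro ⟨k, hk, h⟩
    exact ⟨k, hk, L.endArc_eq_endArc_iff.1 h⟩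
  · rintro ⟨k, hk, rfl | rfl⟩
    · exact ⟨k, hk, rfl⟩
    · exact ⟨k, hk, (L.endArc_endFlip _).symm⟩

/-- **Separation in a glued state** (port of `GaussDiagram.circleOf_ne_of_endGlue_eq_farEnd`).
Let `τ` be a state that agrees with `σ` away from chord `i` and whose gluing at `i` sends the end
`e₀ = (overPos i, out)` to the far end of the walk. Then the arcs of the walk form a union of
circles of `τ` (they are closed under the gluing of `τ`: inner ends are glued by `σ`, and the two
extreme ends `e₀`, `farEnd` to each other) containing `arcOut (overPos i)` but not
`arcIn (overPos i)` (the walk visits chord `i` only at its two extremities, and the far end, the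
`τ`-partner of `e₀`, lies at the under-passage): the two local strands at chord `i` lie on
different circles of `τ`. [folklore] -/
theorem circleOf_ne_of_endGlue_eq_farEnd {σ : L.State} {i : Fin L.n} (τ : L.State)
    (hτ : ∀ e, ¬ L.IsEndAt i e → L.endGlue τ e = L.endGlue σ e)
    (he : L.endGlue τ (L.overPos i, true) = L.farEnd σ i) :
    L.circleOf τ (L.arcIn (L.overPos i)) ≠ L.circleOf τ (L.arcOut (L.overPos i)) := by
  set K := L.strandArcs σ i with hK
  -- `K` is closed under the adjacency of the state graph of `τ`
  have hcl : ∀ ⦃a b : L.Arc⦄, (L.stateGraph τ).Adj a b → a ∈ K → b ∈ K := by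
    intro a b hab ha
    obtain ⟨e, rfl, rfl⟩ := L.exists_end_of_stateGraph_adj τ hab
    obtain ⟨k, hk, rfl | rfl⟩ := (endArc_mem_strandArcs_iff e).1 ha
    · rcases k with _ | k
      · -- the start `e₀` is glued to the far end
        show L.endArc (L.endGlue τ (L.overPos i, true)) ∈ K
        rw [he]
        exact (endArc_mem_strandArcs_iff _).2 ⟨_, le_rfl, Or.inr rfl⟩
      · -- an inner point of the walk is glued back to the previous arc
        have hk' : k < L.returnTime σ i := hk
        rw [hτ _ (not_isEndAt_strandWalk_succ hk'), strandWalk_succ_of_lt hk', endGlue_endGlue]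
        exact (endArc_mem_strandArcs_iff _).2 ⟨k, hk'.le, Or.inr rfl⟩
    · rcases hk.lt_or_eq with hk' | rfl
      · -- the other end of an inner arc is glued forward to the next arc
        rw [hτ _ (not_isEndAt_endFlip_strandWalk hk'), ← strandWalk_succ_of_lt hk']
        exact (endArc_mem_strandArcs_iff _).2 ⟨k + 1, hk', Or.inl rfl⟩
      · -- the far end is glued to the start
        have h2 : L.endGlue τ (L.farEnd σ i) = (L.overPos i, true) := by
          rw [← he, endGlue_endGlue]
        show L.endArc (L.endGlue τ (L.farEnd σ i)) ∈ K
        rw [h2]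
        exact (endArc_mem_strandArcs_iff _).2 ⟨0, Nat.zero_le _, Or.inl rfl⟩
  -- `arcOut o ∈ K`, `arcIn o ∉ K`
  have hout : L.arcOut (L.overPos i) ∈ K := L.arcOut_mem_strandArcs σ i
  have hin : L.arcIn (L.overPos i) ∉ K := by
    intro h
    obtain ⟨k, hk, h | h⟩ := (endArc_mem_strandArcs_iff (L.overPos i, false)).1 h
    · rcases k with _ | k
      · exact Bool.false_ne_true (congrArg Prod.snd h)
      · exact not_isEndAt_strandWalk_succ hk (by rw [← h]; exact Or.inl rfl)
    · rcases hk.lt_or_eq with hk' | rfl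
      · exact not_isEndAt_endFlip_strandWalk hk' (by rw [← h]; exact Or.inl rfl)
      · -- the far end is the `τ`-partner of `e₀`, so its point is `underPos i`
        have h1 : (L.farEnd σ i).1 = L.underPos i := by
          rw [← he]; simp [endGlue]
        exact L.overPos_ne_underPos i i ((congrArg Prod.fst h).trans h1)
  intro hEq
  exact hin (GaussDiagram.mem_of_reachable hcl (SimpleGraph.ConnectedComponent.exact hEq).symm hout)

/-! ## Merge or split -/

/-- At a `0`-smoothed chord, flipping the smoothing flips the Seifert rule (verbatim from the
knot tower). [folklore] -/
theorem isSeifert_update_true {σ : L.State} {i : Fin L.n} (hσ : σ i = false) :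
    L.isSeifert (Function.update σ i true) i = !L.isSeifert σ i := by
  unfold isSeifert
  rw [Function.update_self, hσ]
  generalize (L.sign i == 1) = s
  cases s <;> rfl

/-- The gluing of the end `(overPos i, out)` in a state `τ`: `(underPos i, in)` if the smoothing
of `τ` at `i` is Seifert's, `(underPos i, out)` otherwise (verbatim from the knot tower).
[folklore] -/
theorem endGlue_overPos_true (τ : L.State) (i : Fin L.n) :
    L.endGlue τ (L.overPos i, true) = (L.underPos i, !L.isSeifert τ i) := by
  cases h : L.isSeifert τ i <;> simp [endGlue, h]

/-- **A checkerboard colouring implies the merge/split dichotomy.** If the link Gauss diagram `L`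
admits a checkerboard colouring, then at every `0`-smoothed chord `i` of every state `σ` the edge
`σ → σ[i ↦ 1]` of the cube of resolutions is a merge or a split: the far end of the walk from
`(overPos i, out)` is `(underPos i, in)` or `(underPos i, out)` (`IsCheckerboard.farEnd_fst`),
and the state among `σ`, `σ[i ↦ 1]` whose gluing at `i` realises it separates the two local
strands (`circleOf_ne_of_endGlue_eq_farEnd`). Port of
`GaussDiagram.isMergeAt_or_isSplitAt_of_overPos_mod_two_ne`; Viro (2004), §5.2 (adjacent states
of a planar diagram differ by a Morse modification joining two circles or splitting one);
Rasmussen (2010), Lemma 2.4 (the checkerboard property of link diagrams). [cite: Viro2004, §5.2] -/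
theorem isMergeAt_or_isSplitAt_of_isCheckerboard {c : Fin (2 * L.n) → Bool}
    (hc : L.IsCheckerboard c) {σ : L.State} {i : Fin L.n} (hσ : σ i = false) :
    L.IsMergeAt σ i ∨ L.IsSplitAt σ i := by
  obtain ⟨b, hb⟩ : ∃ b, L.farEnd σ i = (L.underPos i, b) :=
    ⟨_, Prod.ext (hc.farEnd_fst σ i) rfl⟩
  have hτσ : ∀ e, ¬ L.IsEndAt i e → L.endGlue σ e = L.endGlue σ e := fun _ _ ↦ rfl
  have hτσ' : ∀ e, ¬ L.IsEndAt i e →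
      L.endGlue (Function.update σ i true) e = L.endGlue σ e := fun e he ↦ by
    obtain ⟨ho, hu⟩ := not_or.mp he
    exact L.endGlue_update_of_ne σ true ho hu
  have hS' : L.isSeifert (Function.update σ i true) i = !L.isSeifert σ i :=
    isSeifert_update_true hσ
  cases hS : L.isSeifert σ i <;> cases b
  · -- non-Seifert at `i` in `σ`, far end `(u, in)`: `σ[i ↦ 1]` is Seifert at `i` — a split
    right
    refine ⟨hσ, circleOf_ne_of_endGlue_eq_farEnd (Function.update σ i true) hτσ' ?_⟩
    simp only [endGlue_overPos_true, hS', hS, hb, Bool.not_false, Bool.not_true]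
  · -- non-Seifert at `i` in `σ`, far end `(u, out)`: `σ` — a merge
    left
    refine ⟨hσ, circleOf_ne_of_endGlue_eq_farEnd σ hτσ ?_⟩
    simp only [endGlue_overPos_true, hS, hb, Bool.not_false]
  · -- Seifert at `i` in `σ`, far end `(u, in)`: `σ` — a merge
    left
    refine ⟨hσ, circleOf_ne_of_endGlue_eq_farEnd σ hτσ ?_⟩
    simp only [endGlue_overPos_true, hS, hb, Bool.not_true]
  · -- Seifert at `i` in `σ`, far end `(u, out)`: `σ[i ↦ 1]` — a split
    right
    refine ⟨hσ, circleOf_ne_of_endGlue_eq_farEnd (Function.update σ i true) hτσ' ?_⟩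
    simp only [endGlue_overPos_true, hS', hS, hb, Bool.not_false, Bool.not_true]

/-- **The dichotomy, in the shape consumed by the `d² = 0` face analysis**: for a
checkerboard-coloured link Gauss diagram every edge of the cube of resolutions is a merge or a
split. Viro (2004), §5.2; Bar-Natan (2002), §3.1. [cite: BarNatan2002, §3.1] -/
theorem dichotomy_of_isCheckerboard {c : Fin (2 * L.n) → Bool} (hc : L.IsCheckerboard c) :
    ∀ (σ : L.State) (i : Fin L.n), σ i = false → L.IsMergeAt σ i ∨ L.IsSplitAt σ i :=
  fun _ _ hσ ↦ isMergeAt_or_isSplitAt_of_isCheckerboard hc hσ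

/-- The dichotomy for a checkerboard-colourable link Gauss diagram (existential form).
[cite: BarNatan2002, §3.1] -/
theorem dichotomy_of_exists_isCheckerboard (h : ∃ c, L.IsCheckerboard c) :
    ∀ (σ : L.State) (i : Fin L.n), σ i = false → L.IsMergeAt σ i ∨ L.IsSplitAt σ i :=
  fun _ _ hσ ↦ h.elim fun _ hc ↦ isMergeAt_or_isSplitAt_of_isCheckerboard hc hσ

/-- Exclusive form: under a checkerboard colouring an edge is a merge iff it is not a split
(`IsMergeAt.not_isSplitAt` of D2a gives the exclusion). [cite: BarNatan2002, §3.1] -/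
theorem isMergeAt_iff_not_isSplitAt_of_isCheckerboard {c : Fin (2 * L.n) → Bool}
    (hc : L.IsCheckerboard c) {σ : L.State} {i : Fin L.n} (hσ : σ i = false) :
    L.IsMergeAt σ i ↔ ¬ L.IsSplitAt σ i :=
  ⟨IsMergeAt.not_isSplitAt,
    fun h ↦ (isMergeAt_or_isSplitAt_of_isCheckerboard hc hσ).resolve_right h⟩

/-- Under a checkerboard colouring the traversal has no fixed point (the colour alternates along
every component), so the degenerate virtual configuration `arcIn p = arcOut p` (a component
carrying a single marked point) does not occur. [folklore] -/
theorem IsCheckerboard.next_ne {c : Fin (2 * L.n) → Bool} (hc : L.IsCheckerboard c)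
    (p : Fin (2 * L.n)) : L.next p ≠ p := fun h ↦
  absurd ((congrArg c h).symm.trans (hc.apply_next p)).symm (Bool.not_ne_self _)

/-- Hence under a checkerboard colouring the two local strands `arcIn p`, `arcOut p` at a marked
point are distinct arcs. [folklore] -/
theorem IsCheckerboard.arcIn_ne_arcOut {c : Fin (2 * L.n) → Bool} (hc : L.IsCheckerboard c)
    (p : Fin (2 * L.n)) : L.arcIn p ≠ L.arcOut p := fun h ↦
  hc.next_ne (L.next.symm p) (by rw [Equiv.apply_symm_apply]; exact (L.arcOut_injective h).symm)

/-! ## Sanity: knot diagrams, the unlinks, the Hopf link -/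

section Sanity

/-- **The knot statement recovered through the link tower.** On the image of a knot diagram with
Gauss parity, colouring the marked points by parity is a checkerboard colouring
(`isCheckerboard_ofGaussDiagram`), so every edge of the cube of `ofGaussDiagram G` is a merge or a
split. [cite: Viro2004, §5.2] -/
theorem isMergeAt_or_isSplitAt_ofGaussDiagram_of_overPos_mod_two_ne (G : GaussDiagram)
    (hpar : ∀ j : Fin G.n, (G.overPos j).val % 2 ≠ (G.underPos j).val % 2) {σ : G.State}
    {i : Fin G.n} (hσ : σ i = false) :
    (ofGaussDiagram G).IsMergeAt σ i ∨ (ofGaussDiagram G).IsSplitAt σ i :=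
  isMergeAt_or_isSplitAt_of_isCheckerboard (isCheckerboard_ofGaussDiagram G hpar) hσ

/-- **For knot diagrams the dichotomy on the link side is equivalent to Gauss parity** (the knot
tower's `GaussDiagram.dichotomy_iff_overPos_mod_two_ne` read through the correspondence; the
converse direction is `KhResolutionsParityProofs`). For links no such converse holds (a virtual
two-component diagram may satisfy the dichotomy without a checkerboard colouring).
[cite: Viro2004, §5] -/
theorem dichotomy_ofGaussDiagram_iff (G : GaussDiagram) (hG : G.n ≠ 0) :
    (∀ (σ : (ofGaussDiagram G).State) (i : Fin (ofGaussDiagram G).n), σ i = false →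
        (ofGaussDiagram G).IsMergeAt σ i ∨ (ofGaussDiagram G).IsSplitAt σ i) ↔
      ∀ j : Fin G.n, (G.overPos j).val % 2 ≠ (G.underPos j).val % 2 := by
  rw [← GaussDiagram.dichotomy_iff_overPos_mod_two_ne]
  simp only [isMergeAt_ofGaussDiagram_iff G hG, isSplitAt_ofGaussDiagram_iff G hG]
  exact Iff.rfl

/-- Rotation by one on `Fin m` away from the wrap-around is `+ 1` on values. [folklore] -/
theorem val_finRotate_of_lt {m : ℕ} (p : Fin m) (h : p.val + 1 < m) :
    ((finRotate m p : Fin m) : ℕ) = p.val + 1 := by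
  cases m with
  | zero => exact p.elim0
  | succ m =>
    rw [coe_finRotate_of_ne_last]
    exact fun hp ↦ by rw [hp, Fin.val_last] at h; omega

/-- On the image of a knot diagram a checkerboard colouring is the parity colouring up to a
global flip: `c k = c 0 xor [k odd]` (the traversal is `k ↦ k + 1`). [folklore] -/
theorem IsCheckerboard.apply_eq_xor_ofGaussDiagram {G : GaussDiagram} {c : Fin (2 * G.n) → Bool}
    (hc : (ofGaussDiagram G).IsCheckerboard c) (h0 : 0 < 2 * G.n) :
    ∀ (k : ℕ) (hk : k < 2 * G.n), c ⟨k, hk⟩ = (c ⟨0, h0⟩ ^^ decide (k % 2 = 1)) := by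
  intro k
  induction k with
  | zero => intro hk; simp
  | succ k ih =>
    intro hk
    have hk' : k < 2 * G.n := Nat.lt_of_succ_lt hk
    have hnext : ∀ q : Fin (2 * G.n), c (finRotate (2 * G.n) q) = !c q := hc.apply_next
    have hrot : finRotate (2 * G.n) ⟨k, hk'⟩ = ⟨k + 1, hk⟩ :=
      Fin.ext (val_finRotate_of_lt ⟨k, hk'⟩ hk)
    rw [← hrot, hnext, ih hk']
    rcases Nat.mod_two_eq_zero_or_one k with h | h
    · have h' : (k + 1) % 2 = 1 := by omega
      simp [h, h']
    · have h' : ¬ (k + 1) % 2 = 1 := by omega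
      simp [h, h']

/-- **For knot diagrams, checkerboard-colourable is Gauss parity.** The image of a knot diagram
admits a checkerboard colouring iff every chord joins marked points of opposite parity
(`isCheckerboard_ofGaussDiagram` of D2c and, conversely, `apply_eq_xor_ofGaussDiagram` with
`c (underPos j) = !c (overPos j)`): the hypothesis of this file restricts to the knot tower's
exactly. Kauffman (1999), §2. [cite: Kauffman1999, §2] -/
theorem exists_isCheckerboard_ofGaussDiagram_iff (G : GaussDiagram) :
    (∃ c, (ofGaussDiagram G).IsCheckerboard c) ↔
      ∀ j : Fin G.n, (G.overPos j).val % 2 ≠ (G.underPos j).val % 2 := by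
  refine ⟨?_, fun hpar ↦ ⟨_, isCheckerboard_ofGaussDiagram G hpar⟩⟩
  rintro ⟨c, hc⟩ j hj
  have h0 : 0 < 2 * G.n := by have := j.isLt; omega
  have ho : c (G.overPos j) = (c ⟨0, h0⟩ ^^ decide ((G.overPos j).val % 2 = 1)) :=
    hc.apply_eq_xor_ofGaussDiagram h0 _ (G.overPos j).isLt
  have hu : c (G.underPos j) = (c ⟨0, h0⟩ ^^ decide ((G.underPos j).val % 2 = 1)) :=
    hc.apply_eq_xor_ofGaussDiagram h0 _ (G.underPos j).isLt
  have h : c (G.underPos j) = !c (G.overPos j) := hc.apply_underPos j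
  rw [ho, hu, hj] at h
  exact Bool.not_ne_self _ h.symm

/-- Hence **for knot diagrams the three conditions agree**: checkerboard-colourable ⇔ Gauss
parity ⇔ every edge of the cube is a merge or a split (the last equivalence being the knot
tower's `dichotomy_iff_overPos_mod_two_ne`). For links only "checkerboard ⇒ dichotomy"
survives (this file's main theorem). [cite: Viro2004, §5] -/
theorem exists_isCheckerboard_ofGaussDiagram_iff_dichotomy (G : GaussDiagram) (hG : G.n ≠ 0) :
    (∃ c, (ofGaussDiagram G).IsCheckerboard c) ↔
      ∀ (σ : (ofGaussDiagram G).State) (i : Fin (ofGaussDiagram G).n), σ i = false →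
        (ofGaussDiagram G).IsMergeAt σ i ∨ (ofGaussDiagram G).IsSplitAt σ i := by
  rw [exists_isCheckerboard_ofGaussDiagram_iff, dichotomy_ofGaussDiagram_iff G hG]

/-- **The unlinks.** `unknots k` has no chord: the dichotomy holds vacuously (its colourings are
all checkerboard, `isCheckerboard_unknots`). [folklore] -/
theorem dichotomy_unknots (k : ℕ) (σ : (unknots k).State) (i : Fin (unknots k).n) :
    (unknots k).IsMergeAt σ i ∨ (unknots k).IsSplitAt σ i :=
  i.elim0

/-- **The Hopf link.** Every edge of the cube of resolutions of the positive Hopf link diagram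
`hopfLink` of D2a is a merge or a split, by the checkerboard colouring `isCheckerboard_hopfLink`
of D2c. [folklore] -/
theorem dichotomy_hopfLink (σ : hopfLink.State) (i : Fin hopfLink.n) (hσ : σ i = false) :
    hopfLink.IsMergeAt σ i ∨ hopfLink.IsSplitAt σ i :=
  isMergeAt_or_isSplitAt_of_isCheckerboard isCheckerboard_hopfLink hσ

/-- By `decide`: out of the oriented resolution `00` of the Hopf link the edge at chord `1` is a
merge (chord `0`: `isMergeAt_hopfLink` in D2a), `2 → 1` circles. [folklore] -/
theorem isMergeAt_hopfLink_one : hopfLink.IsMergeAt (fun _ ↦ false) ⟨1, by decide⟩ := by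
  set_option maxRecDepth 8000 in decide

/-- By `decide`: out of the mixed state `10` of the Hopf link the edge at chord `1` is a split
(`1 → 2` circles), not a merge. [folklore] -/
theorem isSplitAt_hopfLink_mixed :
    hopfLink.IsSplitAt ![true, false] ⟨1, by decide⟩ ∧
      ¬ hopfLink.IsMergeAt ![true, false] ⟨1, by decide⟩ := by
  set_option maxRecDepth 8000 in decide

/-- By `decide`: out of the other mixed state `01` of the Hopf link the edge at chord `0` is a
split, not a merge. [folklore] -/
theorem isSplitAt_hopfLink_mixed' :
    hopfLink.IsSplitAt ![false, true] ⟨0, by decide⟩ ∧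
      ¬ hopfLink.IsMergeAt ![false, true] ⟨0, by decide⟩ := by
  set_option maxRecDepth 8000 in decide

end Sanity

/-! ## Checkerboard colourings under the Morse moves of D1 -/

section Morse

variable (L)

/-- A birth changes neither the chords nor the traversal: the checkerboard colourings of
`L.birth` are those of `L`. Rasmussen (2010), §4.1. [cite: Rasmussen2010, §4.1] -/
theorem isCheckerboard_birth_iff (c : Fin (2 * L.n) → Bool) :
    L.birth.IsCheckerboard c ↔ L.IsCheckerboard c :=
  ⟨fun h ↦ ⟨h.1, h.2⟩, fun h ↦ ⟨h.1, h.2⟩⟩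

/-- A death changes neither the chords nor the traversal: the checkerboard colourings of
`L.death` are those of `L`. Rasmussen (2010), §4.1. [cite: Rasmussen2010, §4.1] -/
theorem isCheckerboard_death_iff (c : Fin (2 * L.n) → Bool) :
    L.death.IsCheckerboard c ↔ L.IsCheckerboard c :=
  ⟨fun h ↦ ⟨h.1, h.2⟩, fun h ↦ ⟨h.1, h.2⟩⟩

variable {L}

/-- **An oriented saddle preserves checkerboard colourings.** The saddle `saddle p q` of D1
replaces `next` by `next * swap p q` (`p ↦ next q`, `q ↦ next p`); the colouring condition
survives at `p` and `q` iff `c (next q) = !c p` and `c (next p) = !c q`, i.e. iff `c p = c q`: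
the band joins two arcs of the same colour. This is the combinatorial form of "an oriented
saddle is a band between coherently oriented arcs" (Rasmussen (2010), §4.1, Fig. 6).
[cite: Rasmussen2010, §4.1] -/
theorem IsCheckerboard.saddle {c : Fin (2 * L.n) → Bool} (hc : L.IsCheckerboard c)
    {p q : Fin (2 * L.n)} (hpq : c p = c q) : (L.saddle p q).IsCheckerboard c where
  apply_next := by
    show ∀ r : Fin (2 * L.n), c ((L.next * Equiv.swap p q) r) = !c r
    intro r
    rw [Equiv.Perm.mul_apply]
    by_cases hp : r = p
    · rw [hp, Equiv.swap_apply_left, hc.apply_next, hpq]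
    · by_cases hq : r = q
      · rw [hq, Equiv.swap_apply_right, hc.apply_next, hpq]
      · rw [Equiv.swap_apply_of_ne_of_ne hp hq, hc.apply_next]
  apply_underPos := hc.apply_underPos

/-- **The condition is necessary**: if `c` is a checkerboard colouring both before and after the
saddle along the arcs leaving `p` and `q`, then `c p = c q` (an unoriented band destroys every
checkerboard colouring). [cite: Rasmussen2010, §4.1] -/
theorem IsCheckerboard.apply_eq_of_saddle {c : Fin (2 * L.n) → Bool} (hc : L.IsCheckerboard c)
    {p q : Fin (2 * L.n)} (hs : (L.saddle p q).IsCheckerboard c) : c p = c q := by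
  have h := hs.apply_next p
  rw [saddle_next_left, hc.apply_next] at h
  exact (Bool.not_inj h).symm

/-- For a band between arcs of the same colour, `c` is a checkerboard colouring after the saddle
iff it is one before (`saddle_saddle`: the saddle is an involution). [cite: Rasmussen2010, §4.1] -/
theorem isCheckerboard_saddle_iff {c : Fin (2 * L.n) → Bool} {p q : Fin (2 * L.n)}
    (hpq : c p = c q) : (L.saddle p q).IsCheckerboard c ↔ L.IsCheckerboard c := by
  refine ⟨fun h ↦ ⟨fun r ↦ ?_, h.apply_underPos⟩, fun h ↦ h.saddle hpq⟩
  by_cases hp : r = p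
  · rw [hp, ← L.saddle_next_right p q, h.apply_next, hpq]
  · by_cases hq : r = q
    · rw [hq, ← L.saddle_next_left p q, h.apply_next, hpq]
    · rw [← L.saddle_next_of_ne hp hq, h.apply_next]

/-- **The dichotomy persists along oriented Morse moves**: after a birth. [cite: Viro2004, §5.2] -/
theorem dichotomy_birth {c : Fin (2 * L.n) → Bool} (hc : L.IsCheckerboard c) :
    ∀ (σ : L.birth.State) (i : Fin L.birth.n), σ i = false →
      L.birth.IsMergeAt σ i ∨ L.birth.IsSplitAt σ i :=
  dichotomy_of_isCheckerboard ((L.isCheckerboard_birth_iff c).2 hc)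

/-- The dichotomy persists after a death. [cite: Viro2004, §5.2] -/
theorem dichotomy_death {c : Fin (2 * L.n) → Bool} (hc : L.IsCheckerboard c) :
    ∀ (σ : L.death.State) (i : Fin L.death.n), σ i = false →
      L.death.IsMergeAt σ i ∨ L.death.IsSplitAt σ i :=
  dichotomy_of_isCheckerboard ((L.isCheckerboard_death_iff c).2 hc)

/-- The dichotomy persists after an oriented saddle (`c p = c q`). [cite: Viro2004, §5.2] -/
theorem dichotomy_saddle {c : Fin (2 * L.n) → Bool} (hc : L.IsCheckerboard c)
    {p q : Fin (2 * L.n)} (hpq : c p = c q) :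
    ∀ (σ : (L.saddle p q).State) (i : Fin (L.saddle p q).n), σ i = false →
      (L.saddle p q).IsMergeAt σ i ∨ (L.saddle p q).IsSplitAt σ i :=
  dichotomy_of_isCheckerboard (hc.saddle hpq)

end Morse

end LinkGaussDiagram

namespace GaussDiagram

/-- **Consistency with the knot tower.** Transported back along D2a's correspondence of merges
and splits (`isMergeAt_ofGaussDiagram_iff`, `isSplitAt_ofGaussDiagram_iff`), the link dichotomy
on `ofGaussDiagram G` is the statement of the knot tower's
`GaussDiagram.isMergeAt_or_isSplitAt_of_overPos_mod_two_ne`, re-proved here by the walk of this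
file instead of the strand permutation of `KhResolutionsProofs`. [cite: Viro2004, §5.2] -/
theorem isMergeAt_or_isSplitAt_of_overPos_mod_two_ne' {G : GaussDiagram}
    (hpar : ∀ j : Fin G.n, (G.overPos j).val % 2 ≠ (G.underPos j).val % 2) {σ : G.State}
    {i : Fin G.n} (hσ : σ i = false) : G.IsMergeAt σ i ∨ G.IsSplitAt σ i := by
  have hG : G.n ≠ 0 := fun h ↦ absurd i.isLt (by omega)
  have h := LinkGaussDiagram.isMergeAt_or_isSplitAt_ofGaussDiagram_of_overPos_mod_two_ne G hpar hσ
  rwa [LinkGaussDiagram.isMergeAt_ofGaussDiagram_iff G hG,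
    LinkGaussDiagram.isSplitAt_ofGaussDiagram_iff G hG] at h

end GaussDiagram

end Literature.Topology.FourManifolds
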